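import Mathlib
import Summits.ResolutionOfSingularities.ResolutionOfSingularities.Theorems.WildQuotientsWildQuotientResolutionTameQuotientCharts
import Summits.ResolutionOfSingularities.ResolutionOfSingularities.Theorems.FrobeniusLadderFRationalResolutionDiagonalizableQuotientPerfect

/-!
# Peeling frame: Bergh–Rydh (diagonalizable) resolves the glued quotient `X/G` from per-PIECE graded chart data

(crux stmt-ResolutionOfSingularities-15640 `WildQuotients.WildQuotientResolution`, S1 = stmt-…-17941; ℤ9
SPECIMEN brick Z6 (frame twin) of res-L1-w45c-idea-2's `cardP_g12/Z9-SPECIMEN.md` §4, variant V-BR;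
res-L1-w45c-plan-1 GO 2026-08-27T16:29:20Z «Z6 frame twin + final = stub-1». The twin of
`TameQuotient.hasResolution_glued_of_berghRydh` (p? `…TameQuotientCharts`) for the DIAGONALIZABLE named
fact `BerghRydh2019_diagonalizableQuotientResolution`, WITHOUT regularity of `X` (the weighted blow-up
`V = Bl_{I₂₈} 𝔸ⁿ` is not regular) and with the chart data supplied per stable affine PIECE of a chosen
covering family (the K–L / twisted bricks Z4a/Z4T/Z4b), not for every stable affine open.
[OURS · L1 W4.5c] — generic scheme plumbing copied from `TameQuotient.exists_tame_chart`; NOT a statement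
of any manuscript. CONDITIONAL on the named fact (hypothesis `hBR`). Prover res-L1-w45c-stub-1.)

* `exists_gluedι_pieceMk_eq` — for a family of stable affine pieces `Pc i` covering `X`, every point of
  `X/G` is `gluedι (Pc i) (pieceMk (Pc i) x)` for some `i`, `x ∈ Pc i` (`ActionOver.gluedMk_surjective`).
* `hasResolution_glued_of_pieceGradedCharts_of_berghRydh` — **Z6 frame**: `Y` affine over a perfect `k`;
  if for every piece `Pc i` the ring of invariants `Γ(Pc i)^G = (ρ|_{Pc i}).invariants.ring ⊤` is, compatibly
  with `k`, the degree-`0` part `𝒮 0` of a finite-type REGULAR `k`-algebra `S` graded by a finite abelian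
  group, then `X/G` has a resolution of singularities (the chart `Spec (𝒮 0) ≅ Spec Γ(Pc i)^G ↪ (Pc i)/G ↪ X/G`
  is an open immersion, hence étale; regular of finite type over perfect is smooth,
  `FRationalResolution.diagonalizableQuotientResolution_of_perfectField`).
-/

-- single-problem summit: the doubled namespace component `ResolutionOfSingularities` is forced
set_option linter.dupNamespace false

noncomputable section

universe u

open CategoryTheory Limits AlgebraicGeometry TopologicalSpace
open Literature.AlgebraicGeometry.Resolution Literature.AlgebraicGeometry.RelativeSpec

namespace Summit.ResolutionOfSingularities.ResolutionOfSingularities.Theorems.WildQuotientResolution.PeelingFrame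

/-- **Points of `X/G` come from a chosen covering family of pieces.** [folklore] -/
theorem exists_gluedι_pieceMk_eq {X Y : Scheme.{0}} {r : X ⟶ Y} {G : Type} [Group G] [Finite G]
    (ρ : ActionOver r G) [Y.IsSeparated] [IsSeparated r]
    (hcov : ∀ x : X, ∃ O : ρ.StableAffineOpens, x ∈ O.1)
    {ι : Type*} (Pc : ι → ρ.StableAffineOpens) (hPc : ∀ x : X, ∃ i, x ∈ (Pc i).1) (z : ρ.glued) :
    ∃ (i : ι) (x : ↥(Pc i).1), ρ.gluedι (Pc i) (ρ.pieceMk (Pc i) x) = z := by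
  obtain ⟨x, rfl⟩ := ρ.gluedMk_surjective hcov z
  obtain ⟨i, hx⟩ := hPc x
  exact ⟨i, ⟨x, hx⟩, (ρ.gluedMk_apply hcov (Pc i) ⟨x, hx⟩).symm⟩

/-- **Z6 frame — Bergh–Rydh (diagonalizable) resolves `X/G` from per-piece graded chart data.** Let a
finite group `G` act (`ρ`) on `X` over an AFFINE base `Y` (`r : X → Y` separated, quasi-compact), with
`k`-structure `f : Y → Spec k`, `k` perfect; let `Pc i` be stable affine pieces covering `X`, and suppose
`X/G = ρ.glued` is integral and `X/G → Y → Spec k` separated, quasi-compact, locally of finite type. If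
for every `i` there are a finite abelian group `A`, a finite-type REGULAR `k`-algebra `S` graded by `A`
(`𝒮`), and a ring isomorphism `e : 𝒮 0 ≃ Γ(Pc i)^G := (ρ|_{Pc i}).invariants.ring ⊤` compatible with the
`k`-structures (`e (c • 1) = r♯ f♯ c`), then `X/G` has a resolution of singularities. CONDITIONAL on
`BerghRydh2019_diagonalizableQuotientResolution`. [OURS · L1 W4.5c]
[cite: BerghRydh2019, Thm 5 (arXiv:1905.00872, p. 4)] [cite: MumfordAV1970, §7 Thm. p. 66] -/
theorem hasResolution_glued_of_pieceGradedCharts_of_berghRydh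
    (hBR : BerghRydh2019_diagonalizableQuotientResolution)
    {X Y : Scheme.{0}} {r : X ⟶ Y} {G : Type} [Group G] [Finite G]
    (ρ : ActionOver r G) [IsAffine Y] [IsSeparated r] [QuasiCompact r]
    (k : Type) [Field k] [PerfectField k] (f : Y ⟶ Spec (.of k))
    (hcov : ∀ x : X, ∃ O : ρ.StableAffineOpens, x ∈ O.1)
    [IsIntegral ρ.glued] [IsSeparated (ρ.gluedDesc r ρ.aut_comp ≫ f)]
    [LocallyOfFiniteType (ρ.gluedDesc r ρ.aut_comp ≫ f)] [QuasiCompact (ρ.gluedDesc r ρ.aut_comp ≫ f)]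
    {ι : Type*} (Pc : ι → ρ.StableAffineOpens) (hPc : ∀ x : X, ∃ i, x ∈ (Pc i).1)
    (hchart : ∀ i, ∃ (A : Type) (_ : AddCommGroup A) (_ : Finite A) (_ : DecidableEq A)
      (S : Type) (_ : CommRing S) (_ : Algebra k S) (𝒮 : A → Submodule k S) (_ : GradedAlgebra 𝒮),
      Algebra.FiniteType k S ∧ IsRegularRing S ∧
      ∃ e : ↥(𝒮 0) ≃+* ↥((ρ.restrict (Pc i).1 (Pc i).2.1).invariants.ring ⊤),
        ∀ c : k, ((e (algebraMap k (𝒮 0) c) :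
            ↥((ρ.restrict (Pc i).1 (Pc i).2.1).invariants.ring ⊤)) : Γ((Pc i).1, ((Pc i).1.ι ≫ r) ⁻¹ᵁ ⊤)) =
          ((Pc i).1.ι ≫ r).app ⊤ ((f.appLE ⊤ ⊤ le_top) ((Scheme.ΓSpecIso (.of k)).inv c))) :
    Scheme.HasResolution ρ.glued := by
  classical
  haveI : Y.IsSeparated := inferInstance
  refine FRationalResolution.diagonalizableQuotientResolution_of_perfectField hBR k ρ.glued
    (ρ.gluedDesc r ρ.aut_comp ≫ f) fun z => ?_
  obtain ⟨i, x, hz⟩ := exists_gluedι_pieceMk_eq ρ hcov Pc hPc z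
  obtain ⟨A, _, _, _, S, _, _, 𝒮, _, hft, hreg, e, he⟩ := hchart i
  -- the piece, its restricted action, the top affine open of the affine base
  let O := Pc i
  let ρ' := ρ.restrict O.1 O.2.1
  let r' : (O.1 : Scheme.{0}) ⟶ Y := O.1.ι ≫ r
  let U : Y.affineOpens := ⟨⊤, isAffineOpen_top Y⟩
  let κ₀ : CommRingCat.of k ⟶ Γ(Y, U.1) :=
    (Scheme.ΓSpecIso (.of k)).inv ≫ f.appLE ⊤ U.1 le_top
  -- the chart `Spec (𝒮 0) ≅ Spec Γ(O)^G ↪ O/G ↪ X/G`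
  let ε : CommRingCat.of (ρ'.invariants.ring U.1) ⟶ CommRingCat.of ↥(𝒮 0) :=
    CommRingCat.ofHom e.symm.toRingHom
  haveI : IsIso ε := (e.symm.toCommRingCatIso).isIso_hom
  let χ : Spec (.of (ρ'.invariants.ring U.1)) ⟶ ρ.glued :=
    ρ'.invariants.openCover.f U ≫ ρ.gluedι O
  have hχ0 : IsOpenImmersion (ρ'.invariants.openCover.f U ≫ ρ.gluedι O) := inferInstance
  have hχ : IsOpenImmersion χ := hχ0
  let φ : Spec (.of ↥(𝒮 0)) ⟶ ρ.glued := Spec.map ε ≫ χ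
  have hφ : IsOpenImmersion φ := by dsimp only [φ]; infer_instance
  -- compatibility with the `k`-structures
  have h1 : ρ.gluedι O ≫ ρ.gluedDesc r ρ.aut_comp = ρ'.invariants.fromSpec :=
    ρ.gluedι_gluedDesc_base O
  have h2 : U.2.fromSpec ≫ f =
      Spec.map (f.appLE ⊤ U.1 le_top) ≫ Spec.map (Scheme.ΓSpecIso (.of k)).inv := by
    rw [← Scheme.isoSpec_Spec_inv, ← IsAffineOpen.fromSpec_top]
    exact (IsAffineOpen.SpecMap_appLE_fromSpec f (isAffineOpen_top _) U.2 le_top).symm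
  have h2' : (Spec.map (ρ'.invariants.diagramMap.app (.op U.1)) ≫ U.2.fromSpec) ≫ f =
      Spec.map (κ₀ ≫ ρ'.invariants.diagramMap.app (.op U.1)) := by
    rw [Category.assoc, h2, ← Spec.map_comp, ← Spec.map_comp]
  have h3 : ρ'.invariants.openCover.f U ≫ ρ.gluedι O ≫ ρ.gluedDesc r ρ.aut_comp ≫ f =
      Spec.map (κ₀ ≫ ρ'.invariants.diagramMap.app (.op U.1)) := by
    rw [reassoc_of% h1, ρ'.invariants.ι_fromSpec_assoc U]
    exact h2'
  have h3' : χ ≫ ρ.gluedDesc r ρ.aut_comp ≫ f =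
      Spec.map (κ₀ ≫ ρ'.invariants.diagramMap.app (.op U.1)) := h3
  -- the ring-level compatibility `ε ∘ (κ₀ ≫ diagramMap) = algebraMap k (𝒮 0)`
  have hε : (κ₀ ≫ ρ'.invariants.diagramMap.app (.op U.1)) ≫ ε =
      CommRingCat.ofHom (algebraMap k ↥(𝒮 0)) := by
    apply CommRingCat.hom_ext
    refine RingHom.ext fun c => ?_
    change e.symm ((ρ'.invariants.diagramMap.app (.op U.1)) (κ₀ c)) = algebraMap k _ c
    apply e.injective
    rw [e.apply_symm_apply]
    apply Subtype.ext
    rw [he c]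
    rfl
  refine ⟨A, inferInstance, inferInstance, inferInstance, S, inferInstance, inferInstance, 𝒮,
    inferInstance, hft, hreg, φ, ?_, ?_, ?_⟩
  · haveI := hφ
    exact inferInstance
  · -- `z` is in the image
    have hmem : ρ.pieceMk O x ∈ ρ'.invariants.fromSpec ⁻¹ᵁ (U : Y.Opens) := by
      change _ ∈ (⊤ : (ρ.pieceQuot O).Opens)
      exact Opens.mem_top _
    rw [ρ'.invariants.fromSpec_preimage U] at hmem
    obtain ⟨p, hp⟩ := hmem
    obtain ⟨p', rfl⟩ := (Spec.map ε).homeomorph.surjective p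
    refine ⟨p', ?_⟩
    rw [← hz, ← hp]
    rfl
  · -- the `k`-structures
    change (Spec.map ε ≫ χ) ≫ ρ.gluedDesc r ρ.aut_comp ≫ f = _
    rw [Category.assoc, h3']
    refine (Spec.map_comp _ _).symm.trans ?_
    exact congrArg (fun t => Spec.map t) hε

end Summit.ResolutionOfSingularities.ResolutionOfSingularities.Theorems.WildQuotientResolution.PeelingFrame

end
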